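import Literature.NumberTheory.Sieve.MoebiusExpSumDavenport

/-!
# Route `GreenTaoLevelTwo`, crux `MNTwo` (stmt-Parity-21276), line `birth`, stub `stub_mnVertical`:
# Fejér smoothing of periodic Lipschitz functions and Möbius against exponential polynomials
# (GT 2008b §6 (mu-1-step) with App. Lemma (fourier-approx), one-dimensional tools)

Second brick of block V1 of the `stub_mnVertical` census (tools; the estimate itself is assembled in
`…MNTwoMoebiusLipschitzCircle`) (B. Green, T. Tao, *Quadratic uniformity of
the Möbius function*, Ann. Inst. Fourier 58 (2008) = arXiv:math/0606087, §6 proof of (mu-1-step) with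
App. Lemma (fourier-approx)): for a `1`-periodic `1`-bounded `M`-Lipschitz `f : ℝ → ℂ` and a rotation
`α`, `‖∑_{n ≤ N} μ(n) f(x + nα)‖ ≤ C_A · M · N / log^A N`.  Proof: Fejér smoothing
`σ_H f(y) = ∫₀¹ f(y−t) K_H(t) dt` (tree: `FejerCounting.fejerKernel`, mean one, tail
`∫_δ^{1−δ} K_H ≤ 1/(2(H+1)δ)`) is a trigonometric polynomial with `(H+1)²` coefficients of size
`≤ (H+1)⁻¹` and `|σ_H f − f| ≤ Mδ + 1/((H+1)δ)`; each character is handled by Davenport's theorem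
(tree: `MoebiusDavenport.davenport`).  Def-free:

* `norm_sum_moebius_expPoly_le` — Möbius against `∑_t c_t e(θ_t + nβ_t)` (any finite index set, real
  frequencies): `≤ C_A (∑_t ‖c_t‖) N / log^A N`;
* `fejer_smoothing_eq_sum` — `σ_H f(y) = ∑_{n,n' ≤ H+1} c_{n,n'} e((n−n')y)`;
* `norm_fejer_smoothing_sub_le` — `‖σ_H f(y) − f(y)‖ ≤ Mδ + 1/((H+1)δ)`.

References: [GreenTao2008QuadraticMobius] arXiv:math/0606087 §6, App. Lemma (fourier-approx);
H. Davenport, Quart. J. Math. 8 (1937) 313–320.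
-/

noncomputable section

open Finset Real MeasureTheory intervalIntegral ArithmeticFunction
open scoped FourierTransform ArithmeticFunction.Moebius

namespace Summit.Parity.GeneralizedHardyLittlewood.GreenTaoLevelTwoMNTwoFejerSmoothing

open Literature.NumberTheory.Sieve.Vinogradov (afExpSum norm_fourierChar)
open Literature.NumberTheory.Sieve.MoebiusDavenport (davenport)
open Literature.NumberTheory.Sieve.FejerCounting (fejerKernel fejerKernel_nonneg fejerKernel_eq_sum
  continuous_fejerKernel intervalIntegrable_fejerKernel integral_fejerKernel integral_fejerKernel_tail_le
  fejerKernel_add_intCast continuous_fourierChar_mul fourierChar_add_intCast)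

/-! ### §1 Möbius against exponential polynomials -/

/-- **Möbius against an exponential polynomial (Davenport, term by term).**  For every `A > 0` there
is `C ≥ 0` with `‖∑_{n ≤ N} μ(n) ∑_{t ∈ T} c_t e(θ_t + n β_t)‖ ≤ C (∑_t ‖c_t‖) N / log^A N` for all
`N ≥ 2`, all finite index sets `T` and all real `θ_t, β_t`, complex `c_t`.
[cite: GreenTao2008QuadraticMobius, §6, (mu-1-step)] -/
theorem norm_sum_moebius_expPoly_le {A : ℝ} (hA : 0 < A) :
    ∃ C : ℝ, 0 ≤ C ∧ ∀ N : ℕ, 2 ≤ N → ∀ {ι : Type*} (T : Finset ι) (c : ι → ℂ) (θ β : ι → ℝ),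
      ‖∑ n ∈ Icc 1 N, ((μ n : ℝ) : ℂ) * ∑ t ∈ T, c t * (𝐞 (θ t + n * β t) : ℂ)‖ ≤
        C * (∑ t ∈ T, ‖c t‖) * N / Real.log N ^ A := by
  obtain ⟨C, hC⟩ := davenport A hA
  refine ⟨max C 0, le_max_right _ _, fun N hN ι T c θ β => ?_⟩
  have hlog : 0 < Real.log N := Real.log_pos (by exact_mod_cast (show 1 < N by omega))
  have hden : 0 < Real.log N ^ A := Real.rpow_pos_of_pos hlog A
  have hNpos : (0 : ℝ) < N := by exact_mod_cast (show 0 < N by omega)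
  have hdav : ∀ b : ℝ, ‖afExpSum (fun n => (μ n : ℝ)) N b‖ ≤ max C 0 * N / Real.log N ^ A := by
    intro b
    refine (hC N hN b).trans ?_
    rw [div_le_div_iff_of_pos_right hden]
    exact mul_le_mul_of_nonneg_right (le_max_left _ _) hNpos.le
  have hswap : ∑ n ∈ Icc 1 N, ((μ n : ℝ) : ℂ) * ∑ t ∈ T, c t * (𝐞 (θ t + n * β t) : ℂ) =
      ∑ t ∈ T, c t * (𝐞 (θ t) : ℂ) * afExpSum (fun n => (μ n : ℝ)) N (β t) := by
    simp_rw [Finset.mul_sum]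
    rw [Finset.sum_comm]
    refine Finset.sum_congr rfl fun t _ => ?_
    unfold afExpSum
    rw [Finset.mul_sum]
    refine Finset.sum_congr rfl fun n _ => ?_
    rw [AddChar.map_add_eq_mul, Circle.coe_mul]
    push_cast
    ring
  rw [hswap]
  calc ‖∑ t ∈ T, c t * (𝐞 (θ t) : ℂ) * afExpSum (fun n => (μ n : ℝ)) N (β t)‖
      ≤ ∑ t ∈ T, ‖c t * (𝐞 (θ t) : ℂ) * afExpSum (fun n => (μ n : ℝ)) N (β t)‖ := norm_sum_le _ _
    _ ≤ ∑ t ∈ T, ‖c t‖ * (max C 0 * N / Real.log N ^ A) := Finset.sum_le_sum fun t _ => by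
        rw [norm_mul, norm_mul, norm_fourierChar, mul_one]
        exact mul_le_mul_of_nonneg_left (hdav _) (norm_nonneg _)
    _ = max C 0 * (∑ t ∈ T, ‖c t‖) * N / Real.log N ^ A := by
        rw [← Finset.sum_mul]; ring

/-! ### §2 Fejér smoothing of a periodic Lipschitz function -/

/-- **The Fejér smoothing is an exponential polynomial**: for `f` continuous and `1`-periodic,
`∫₀¹ f(y−t) K_H(t) dt = ∑_{n,n' ∈ (0,H+1]} c_{n,n'} e((n−n') y)` with
`c_{n,n'} = (H+1)⁻¹ ∫₀¹ f(s) e((n'−n)s) ds`. [cite: GreenTao2008QuadraticMobius, App., Lemma (fourier-approx)] -/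
theorem fejer_smoothing_eq_sum {f : ℝ → ℂ} (hf : Continuous f) (hper : Function.Periodic f 1)
    (H : ℕ) (y : ℝ) :
    ∫ t in (0 : ℝ)..1, f (y - t) * (fejerKernel H t : ℂ) =
      ∑ n ∈ Ioc 0 (H + 1), ∑ n' ∈ Ioc 0 (H + 1),
        (((H : ℂ) + 1)⁻¹ * ∫ s in (0 : ℝ)..1, f s * (𝐞 (((n' : ℝ) - n) * s) : ℂ)) *
          (𝐞 (((n : ℝ) - n') * y) : ℂ) := by
  have hcont : ∀ n n' : ℕ, Continuous fun t : ℝ => f (y - t) * (𝐞 (((n : ℝ) - n') * t) : ℂ) :=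
    fun n n' => (hf.comp (continuous_const.sub continuous_id)).mul (continuous_fourierChar_mul _)
  -- expand the kernel
  have h1 : ∫ t in (0 : ℝ)..1, f (y - t) * (fejerKernel H t : ℂ) =
      ((H : ℂ) + 1)⁻¹ * ∑ n ∈ Ioc 0 (H + 1), ∑ n' ∈ Ioc 0 (H + 1),
        ∫ t in (0 : ℝ)..1, f (y - t) * (𝐞 (((n : ℝ) - n') * t) : ℂ) := by
    simp_rw [fejerKernel_eq_sum]
    have e : ∀ t : ℝ, f (y - t) * (((H : ℂ) + 1)⁻¹ *
        ∑ n ∈ Ioc 0 (H + 1), ∑ n' ∈ Ioc 0 (H + 1), (𝐞 (((n : ℝ) - n') * t) : ℂ)) =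
        ((H : ℂ) + 1)⁻¹ * ∑ n ∈ Ioc 0 (H + 1), ∑ n' ∈ Ioc 0 (H + 1),
          f (y - t) * (𝐞 (((n : ℝ) - n') * t) : ℂ) := by
      intro t
      rw [Finset.mul_sum, Finset.mul_sum, Finset.mul_sum]
      refine Finset.sum_congr rfl fun n _ => ?_
      rw [Finset.mul_sum, Finset.mul_sum, Finset.mul_sum]
      refine Finset.sum_congr rfl fun n' _ => ?_
      ring
    simp_rw [e]
    rw [intervalIntegral.integral_const_mul, intervalIntegral.integral_finsetSum (fun n _ =>
      (continuous_finsetSum _ fun n' _ => hcont n n').intervalIntegrable _ _)]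
    congr 1
    refine Finset.sum_congr rfl fun n _ => ?_
    rw [intervalIntegral.integral_finsetSum (fun n' _ => (hcont n n').intervalIntegrable _ _)]
  rw [h1, Finset.mul_sum]
  refine Finset.sum_congr rfl fun n _ => ?_
  rw [Finset.mul_sum]
  refine Finset.sum_congr rfl fun n' _ => ?_
  -- substitute `s = y - t` and use periodicity
  have h2 : ∫ t in (0 : ℝ)..1, f (y - t) * (𝐞 (((n : ℝ) - n') * t) : ℂ) =
      ∫ s in (y - 1)..y, f s * (𝐞 (((n : ℝ) - n') * (y - s)) : ℂ) := by
    have := intervalIntegral.integral_comp_sub_left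
      (fun s => f s * (𝐞 (((n : ℝ) - n') * (y - s)) : ℂ)) y (a := (0 : ℝ)) (b := 1)
    simp only [sub_sub_cancel, sub_zero] at this
    rw [this]
  have hperI : Function.Periodic (fun s => f s * (𝐞 (((n : ℝ) - n') * (y - s)) : ℂ)) 1 := by
    intro s
    simp only
    rw [hper s]
    congr 1
    have e : ((n : ℝ) - n') * (y - (s + 1)) = ((n : ℝ) - n') * (y - s) + (((n' : ℤ) - n : ℤ) : ℝ) := by
      push_cast; ring
    rw [e, fourierChar_add_intCast]
  have h3 : ∫ s in (y - 1)..y, f s * (𝐞 (((n : ℝ) - n') * (y - s)) : ℂ) =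
      ∫ s in (0 : ℝ)..1, f s * (𝐞 (((n : ℝ) - n') * (y - s)) : ℂ) := by
    have := hperI.intervalIntegral_add_eq (y - 1) 0
    rw [show y - 1 + 1 = y by ring, zero_add] at this
    exact this
  rw [h2, h3]
  have h4 : ∀ s : ℝ, f s * (𝐞 (((n : ℝ) - n') * (y - s)) : ℂ) =
      (𝐞 (((n : ℝ) - n') * y) : ℂ) * (f s * (𝐞 (((n' : ℝ) - n) * s) : ℂ)) := by
    intro s
    have e : ((n : ℝ) - n') * (y - s) = ((n : ℝ) - n') * y + ((n' : ℝ) - n) * s := by ring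
    rw [e, AddChar.map_add_eq_mul, Circle.coe_mul]
    ring
  simp_rw [h4]
  rw [intervalIntegral.integral_const_mul]
  ring

/-- The coefficients of the Fejér smoothing are small: `‖(H+1)⁻¹ ∫₀¹ f(s) e(hs) ds‖ ≤ (H+1)⁻¹` for
`‖f‖ ≤ 1`. [folklore] -/
theorem norm_coeff_le {f : ℝ → ℂ} (hf1 : ∀ s, ‖f s‖ ≤ 1) (H : ℕ) (h : ℝ) :
    ‖((H : ℂ) + 1)⁻¹ * ∫ s in (0 : ℝ)..1, f s * (𝐞 (h * s) : ℂ)‖ ≤ ((H : ℝ) + 1)⁻¹ := by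
  have hH : (0 : ℝ) < H + 1 := by positivity
  rw [norm_mul, norm_inv]
  have e : ‖((H : ℂ) + 1)‖ = (H : ℝ) + 1 := by
    rw [show ((H : ℂ) + 1) = (((H : ℝ) + 1 : ℝ) : ℂ) by push_cast; ring, Complex.norm_real,
      Real.norm_eq_abs, abs_of_pos hH]
  rw [e]
  have hint : ‖∫ s in (0 : ℝ)..1, f s * (𝐞 (h * s) : ℂ)‖ ≤ 1 := by
    have := intervalIntegral.norm_integral_le_of_norm_le_const (a := (0 : ℝ)) (b := 1) (C := 1)
      (f := fun s => f s * (𝐞 (h * s) : ℂ)) (fun s _ => by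
        rw [norm_mul, norm_fourierChar, mul_one]; exact hf1 s)
    simpa using this
  calc ((H : ℝ) + 1)⁻¹ * ‖∫ s in (0 : ℝ)..1, f s * (𝐞 (h * s) : ℂ)‖ ≤ ((H : ℝ) + 1)⁻¹ * 1 :=
        mul_le_mul_of_nonneg_left hint (by positivity)
    _ = ((H : ℝ) + 1)⁻¹ := mul_one _

/-- **Error of the Fejér smoothing**: for `f` `1`-periodic, `‖f‖ ≤ 1`, `M`-Lipschitz, and
`0 < δ ≤ 1/2`: `‖∫₀¹ f(y−t)K_H(t)dt − f(y)‖ ≤ Mδ + 1/((H+1)δ)`.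
[cite: GreenTao2008QuadraticMobius, App., Lemma (fourier-approx)] -/
theorem norm_fejer_smoothing_sub_le {f : ℝ → ℂ} (hf : Continuous f) (hper : Function.Periodic f 1)
    (hf1 : ∀ s, ‖f s‖ ≤ 1) {M : ℝ} (hM : 0 ≤ M) (hlip : ∀ x y, ‖f x - f y‖ ≤ M * |x - y|)
    (H : ℕ) {δ : ℝ} (hδ : 0 < δ) (hδ2 : δ ≤ 1 / 2) (y : ℝ) :
    ‖(∫ t in (0 : ℝ)..1, f (y - t) * (fejerKernel H t : ℂ)) - f y‖ ≤ M * δ + 1 / ((H + 1) * δ) := by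
  have hK := integral_fejerKernel H 0
  rw [zero_add] at hK
  have hcontg : Continuous fun t : ℝ => (f (y - t) - f y) * (fejerKernel H t : ℂ) :=
    ((hf.comp (continuous_const.sub continuous_id)).sub continuous_const).mul
      (Complex.continuous_ofReal.comp (continuous_fejerKernel H))
  have hig : ∀ a b : ℝ, IntervalIntegrable (fun t : ℝ => (f (y - t) - f y) * (fejerKernel H t : ℂ))
      volume a b := fun a b => hcontg.intervalIntegrable _ _
  -- rewrite the difference as one integral
  have hInt1 : IntervalIntegrable (fun t : ℝ => f (y - t) * (fejerKernel H t : ℂ)) volume 0 1 :=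
    ((hf.comp (continuous_const.sub continuous_id)).mul
      (Complex.continuous_ofReal.comp (continuous_fejerKernel H))).intervalIntegrable _ _
  have hInt2 : IntervalIntegrable (fun t : ℝ => f y * (fejerKernel H t : ℂ)) volume 0 1 :=
    (continuous_const.mul (Complex.continuous_ofReal.comp (continuous_fejerKernel H))).intervalIntegrable _ _
  have h1 : ∫ t in (0 : ℝ)..1, f y * (fejerKernel H t : ℂ) = f y := by
    rw [intervalIntegral.integral_const_mul, intervalIntegral.integral_ofReal, hK]; simp
  have hdiff : (∫ t in (0 : ℝ)..1, f (y - t) * (fejerKernel H t : ℂ)) - f y =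
      ∫ t in (0 : ℝ)..1, (f (y - t) - f y) * (fejerKernel H t : ℂ) := by
    have h2 : ∫ t in (0 : ℝ)..1, (f (y - t) - f y) * (fejerKernel H t : ℂ) =
        ∫ t in (0 : ℝ)..1, (f (y - t) * (fejerKernel H t : ℂ) - f y * (fejerKernel H t : ℂ)) :=
      intervalIntegral.integral_congr fun t _ => by ring
    rw [h2, intervalIntegral.integral_sub hInt1 hInt2, h1]
  rw [hdiff]
  -- pointwise bounds on the three pieces
  have hnormK : ∀ t, ‖(fejerKernel H t : ℂ)‖ = fejerKernel H t := fun t => by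
    rw [Complex.norm_real, Real.norm_eq_abs, abs_of_nonneg (fejerKernel_nonneg H t)]
  have hnear : ∀ t, |t| ≤ δ → ‖(f (y - t) - f y) * (fejerKernel H t : ℂ)‖ ≤ M * δ * fejerKernel H t := by
    intro t ht
    rw [norm_mul, hnormK]
    refine mul_le_mul_of_nonneg_right ?_ (fejerKernel_nonneg H t)
    calc ‖f (y - t) - f y‖ ≤ M * |y - t - y| := hlip _ _
      _ = M * |t| := by rw [show y - t - y = -t by ring, abs_neg]
      _ ≤ M * δ := mul_le_mul_of_nonneg_left ht hM
  have hnear' : ∀ t, |t - 1| ≤ δ →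
      ‖(f (y - t) - f y) * (fejerKernel H t : ℂ)‖ ≤ M * δ * fejerKernel H t := by
    intro t ht
    rw [norm_mul, hnormK]
    refine mul_le_mul_of_nonneg_right ?_ (fejerKernel_nonneg H t)
    have e : f (y - t) = f (y - t + 1) := (hper _).symm
    calc ‖f (y - t) - f y‖ = ‖f (y - t + 1) - f y‖ := by rw [e]
      _ ≤ M * |y - t + 1 - y| := hlip _ _
      _ = M * |t - 1| := by rw [show y - t + 1 - y = -(t - 1) by ring, abs_neg]
      _ ≤ M * δ := mul_le_mul_of_nonneg_left ht hM
  have hfar : ∀ t, ‖(f (y - t) - f y) * (fejerKernel H t : ℂ)‖ ≤ 2 * fejerKernel H t := by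
    intro t
    rw [norm_mul, hnormK]
    refine mul_le_mul_of_nonneg_right ?_ (fejerKernel_nonneg H t)
    calc ‖f (y - t) - f y‖ ≤ ‖f (y - t)‖ + ‖f y‖ := norm_sub_le _ _
      _ ≤ 1 + 1 := add_le_add (hf1 _) (hf1 _)
      _ = 2 := by norm_num
  -- split `[0,1] = [0,δ] ∪ [δ,1-δ] ∪ [1-δ,1]`
  have hδ1 : δ ≤ 1 - δ := by linarith
  rw [← intervalIntegral.integral_add_adjacent_intervals (b := δ) (hig _ _) (hig _ _),
    ← intervalIntegral.integral_add_adjacent_intervals (a := δ) (b := 1 - δ) (c := 1) (hig _ _) (hig _ _)]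
  have hI1 : ‖∫ t in (0 : ℝ)..δ, (f (y - t) - f y) * (fejerKernel H t : ℂ)‖ ≤
      ∫ t in (0 : ℝ)..δ, M * δ * fejerKernel H t := by
    refine intervalIntegral.norm_integral_le_of_norm_le hδ.le ?_ ?_
    · exact Filter.Eventually.of_forall fun t ht => hnear t (by
        rw [abs_of_nonneg ht.1.le]; exact ht.2)
    · exact ((intervalIntegrable_fejerKernel H _ _).const_mul _)
  have hI2 : ‖∫ t in δ..(1 - δ), (f (y - t) - f y) * (fejerKernel H t : ℂ)‖ ≤
      ∫ t in δ..(1 - δ), 2 * fejerKernel H t := by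
    refine intervalIntegral.norm_integral_le_of_norm_le hδ1 ?_ ?_
    · exact Filter.Eventually.of_forall fun t _ => hfar t
    · exact ((intervalIntegrable_fejerKernel H _ _).const_mul _)
  have hI3 : ‖∫ t in (1 - δ)..1, (f (y - t) - f y) * (fejerKernel H t : ℂ)‖ ≤
      ∫ t in (1 - δ)..1, M * δ * fejerKernel H t := by
    refine intervalIntegral.norm_integral_le_of_norm_le (by linarith) ?_ ?_
    · exact Filter.Eventually.of_forall fun t ht => hnear' t (by
        rw [abs_of_nonpos (by linarith [ht.2])]; linarith [ht.1])
    · exact ((intervalIntegrable_fejerKernel H _ _).const_mul _)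
  -- the kernel integrals
  have hpos : ∀ a b : ℝ, a ≤ b → 0 ≤ ∫ t in a..b, fejerKernel H t := fun a b hab =>
    intervalIntegral.integral_nonneg hab fun t _ => fejerKernel_nonneg H t
  have hsplitK : (∫ t in (0 : ℝ)..δ, fejerKernel H t) + (∫ t in δ..(1 - δ), fejerKernel H t) +
      (∫ t in (1 - δ)..1, fejerKernel H t) = 1 := by
    rw [intervalIntegral.integral_add_adjacent_intervals (intervalIntegrable_fejerKernel H _ _)
      (intervalIntegrable_fejerKernel H _ _), intervalIntegral.integral_add_adjacent_intervals
      (intervalIntegrable_fejerKernel H _ _) (intervalIntegrable_fejerKernel H _ _), hK]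
  have hends : (∫ t in (0 : ℝ)..δ, fejerKernel H t) + (∫ t in (1 - δ)..1, fejerKernel H t) ≤ 1 := by
    linarith [hpos δ (1 - δ) hδ1]
  have htail := integral_fejerKernel_tail_le H hδ hδ2
  rw [intervalIntegral.integral_const_mul] at hI1 hI3
  rw [intervalIntegral.integral_const_mul] at hI2
  have hMδ : 0 ≤ M * δ := mul_nonneg hM hδ.le
  have hH : (0 : ℝ) < H + 1 := by positivity
  calc ‖(∫ t in (0 : ℝ)..δ, (f (y - t) - f y) * (fejerKernel H t : ℂ)) +
        ((∫ t in δ..(1 - δ), (f (y - t) - f y) * (fejerKernel H t : ℂ)) +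
        ∫ t in (1 - δ)..1, (f (y - t) - f y) * (fejerKernel H t : ℂ))‖
      ≤ ‖∫ t in (0 : ℝ)..δ, (f (y - t) - f y) * (fejerKernel H t : ℂ)‖ +
        (‖∫ t in δ..(1 - δ), (f (y - t) - f y) * (fejerKernel H t : ℂ)‖ +
        ‖∫ t in (1 - δ)..1, (f (y - t) - f y) * (fejerKernel H t : ℂ)‖) :=
          (norm_add_le _ _).trans (add_le_add le_rfl (norm_add_le _ _))
    _ ≤ M * δ * (∫ t in (0 : ℝ)..δ, fejerKernel H t) + (2 * (∫ t in δ..(1 - δ), fejerKernel H t) +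
        M * δ * (∫ t in (1 - δ)..1, fejerKernel H t)) := add_le_add hI1 (add_le_add hI2 hI3)
    _ = M * δ * ((∫ t in (0 : ℝ)..δ, fejerKernel H t) + ∫ t in (1 - δ)..1, fejerKernel H t) +
        2 * (∫ t in δ..(1 - δ), fejerKernel H t) := by ring
    _ ≤ M * δ * 1 + 2 * (1 / (2 * (H + 1) * δ)) :=
        add_le_add (mul_le_mul_of_nonneg_left hends hMδ) (mul_le_mul_of_nonneg_left htail (by norm_num))
    _ = M * δ + 1 / ((H + 1) * δ) := by field_simp

end Summit.Parity.GeneralizedHardyLittlewood.GreenTaoLevelTwoMNTwoFejerSmoothing
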